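import Summits.QuantumFields.BalabanUV.Beta.CombHId2W2Mixed

/-!
# `BalabanUV.Beta.CombHId2W2Vertex2` — binder row D1 (OWNER an2), (J-a) dictionary, (C2) at ORDER 2, part TWO-c (words, continued): **WORD 1 — THE BI-VERTEX
# `vertex2OfK K N S₂ b (b′+M′∘n)` UNDER THE DOOR's COPY SUM AND PERIODISATION**: `Σ'_n vertex2OfK K N S₂ b (b′+M′∘n) = vertex2OfK K N S₂^{csf} b b′` (the second FINE bond
# copy-summed) and `dper M` of it `= vertex2OfK K N S₂^{per,csf} b b′`, `S₂^{per,csf} κ u κ′ u′ := dper M (x z ↦ Σ'_n S₂ κ u κ′ (u′+M∘n) x z)`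

WHY.  `vertex2OfK K N S₂ b b′ = vertexOfK K N (κ u ↦ vertexOfK K N (S₂ κ u) b′) b` (`SecondOrderResponse`): both fine bonds of the level-`j` second-order table `S₂ = T2_j` read
through the columns of `K`; the door's copy sum moves the INNER bond, exactly as for the mixed table in `CombHId2W2Words` §2 with `vertexOfM ↦ vertexOfK` and
`LocStencilFM ↦ LocStencil₂`.  The resulting slot shape `S₂^{per,csf}` — copy-sum the second fine bond with the fine period, then periodise — is the one
`CombHId2Record.dper_tsum_T2comb_succ` DELIVERS one level down: the dictionary closes on itself.
WHAT ([folklore]; 0 `def`, 0 cited fact, 0 `def … : Prop`, 0 sorry): §6 `abs_S₂_copy_le`, **`tsum_word₁₂`** (pointwise), `biLoc_S₂_csf`, **`dper_tsum_word₁₂`**.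
NOT HERE: the swapped orientation (it follows wholesale from the block covariance of `W2OfK` — `CombHId2W2Sym`); nothing of Bałaban's asserted; NOT D1,
NEVER «G-an2-4 closed», NOT BetaPertH, NOT continuum, NOT Clay.

HONEST DEPENDENCY (page 1, mandatory): continuum YM on T⁴ ⇐ BetaPertH ∧ nine spine estimates (0/9 proved); BetaPertH ⇐ (D1) ∧ (D4) ∧ CAP+tail;
G-an2-4 gates asym, D1 and NE2/3/4.  HONEST FRAMING (cell contract, verbatim): «discharging `BetaPertH` makes Bałaban's UV stability UNCONDITIONAL —
a real constructive-QFT result; it is NOT the continuum limit and NOT the Clay problem.»  ABSOLUTE RULE (cell charter, verbatim): «No internally-minted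
statement may enter as a cited fact. Every hypothesis is either kernel-proved in this package or a verbatim quotation of a PUBLISHED theorem with page
reference. The manuscript(s) under audit are NOT citable for their own disputed steps — they are the thing under adjudication; programme-internal
(2001/route/tribunal) claims are never citable.»  Row D1 OWNER an2 (b2b-balaban-beta-an2) gen 44, 2026-08-23; over `CombHId2W2Letters∕Exchange∕Slot` BY NAME.
-/

noncomputable section

open scoped BigOperators

namespace Summit.QuantumFields.BalabanUV.Beta.CombHId2W2Vertex2

open Literature.MathematicalPhysics.QuantumFieldTheory.Balaban1983to89
open Literature.MathematicalPhysics.QuantumFieldTheory.Balaban1983to89.Beta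
open B12Sec2to5 (l1 l1_nonneg)
open B4TorusKernel.MultiPeriod (translate translate_apply)
open B4Sect5Proof (latticeConst latticeConst_nonneg)
open ExpKernelCalculus (MKer Decays BiLoc comp shiftK l1_sub_symm)
open AffineAveraging (Site)
open OneStepResolventKernel (Fib)
open OneStepKernelFamily (vertexOfK)
open BalabanCompositeJets (LocStencil₂)
open SecondOrderResponse (vertex2OfK)
open Summit.QuantumFields.BalabanUV.Beta.FP.KernelPeriodisationFibLoc (dper dper_apply summable_exp_l1_translate)
open Summit.QuantumFields.BalabanUV.Beta.CombHId2W2Exchange (vertexOfK_translate_per dper_vertexOfK' dper_vertexOfK_of_biLocAt)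
open Summit.QuantumFields.BalabanUV.Beta.CombHId2W2Slot (tsum_vertexOfK_slot abs_vertexOfK_le_of_far biLoc_vertexOfK_of_biLocAt)

variable {d : ℕ} (M : Fin (d + 1) → ℕ) [∀ μ, NeZero (M μ)] {N : ℕ} [NeZero N] {M' : Fin (d + 1) → ℕ} {K : MKer (d + 1) (Fib d)}
  {CK δK C₂ δ₂ : ℝ} {S₂ : Fin (d + 1) → Site (d + 1) → Fin (d + 1) → Site (d + 1) → MKer (d + 1) (Fib d)}

/-! ## §6 Word 1: the bi-vertex with the moving bond inside -/

omit [∀ μ, NeZero (M μ)] [NeZero N] in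
/-- [folklore] the copy of a `LocStencil₂` table at the shifted second fine bond is localised away from `u + M∘(−n)` in that bond:
`|S₂ κ u κ′ (u′ + M∘n) x z a c| ≤ C₂·e^{−δ₂|u + M∘(−n) − u′|₁}`. -/
theorem abs_S₂_copy_le (hS₂ : LocStencil₂ S₂ C₂ δ₂) (hδ₂ : 0 ≤ δ₂)
    (κ : Fin (d + 1)) (u n : Site (d + 1)) (κ' : Fin (d + 1)) (u' x z : Site (d + 1)) (a c : Fib d) :
    |S₂ κ u κ' (translate M u' n) x z a c| ≤ C₂ * Real.exp (-δ₂ * l1 (translate M u (-n) - u')) := by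
  have hC₂ : 0 ≤ C₂ := by
    have h := (hS₂ κ u κ u).nonneg (Sum.inl 0)
    rwa [sub_self, show l1 (0 : Site (d + 1)) = 0 by simp [l1], mul_zero, Real.exp_zero, mul_one] at h
  refine (hS₂ κ u κ' (translate M u' n) x z a c).trans ?_
  have e : l1 (translate M u' n - u) = l1 (translate M u (-n) - u') := by
    rw [l1_sub_symm]; congr 1; funext i; simp only [Pi.sub_apply, translate_apply, Pi.neg_apply, mul_neg]; ring
  rw [e]
  have h1 : Real.exp (-δ₂ * (l1 (x - u) + l1 (z - u))) ≤ 1 := by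
    rw [Real.exp_le_one_iff]; exact mul_nonpos_of_nonpos_of_nonneg (neg_nonpos.2 hδ₂) (add_nonneg (l1_nonneg _) (l1_nonneg _))
  calc C₂ * Real.exp (-δ₂ * l1 (translate M u (-n) - u')) * Real.exp (-δ₂ * (l1 (x - u) + l1 (z - u)))
      ≤ C₂ * Real.exp (-δ₂ * l1 (translate M u (-n) - u')) * 1 := mul_le_mul_of_nonneg_left h1 (by positivity)
    _ = _ := mul_one _

omit [NeZero N] in
/-- [folklore] **`Σ'_n vertex2OfK K N S₂ b (b′+M′∘n) = vertex2OfK K N S₂^{csf} b b′`** (pointwise), `S₂^{csf} κ u κ′ u′ := x z a c ↦ Σ'_n S₂ κ u κ′ (u′+M∘n) x z a c`. -/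
theorem tsum_word₁₂ (hM : ∀ i, M i = N * M' i)
    (hKinv : ∀ (m x z : Site (d + 1)) (a b : Fib d), K (translate M x m) (translate M z m) a b = K x z a b)
    (hK : Decays K CK δK) (hδK : 0 < δK) (hS₂ : LocStencil₂ S₂ C₂ δ₂) (hδ₂ : 0 < δ₂)
    (μ : Fin (d + 1)) (y : Site (d + 1)) (ν : Fin (d + 1)) (y' : Site (d + 1)) (x z : Site (d + 1)) (a c : Fib d) :
    ∑' n : Site (d + 1), vertex2OfK K N S₂ μ y ν (translate M' y' n) x z a c
      = vertex2OfK K N (fun κ u κ' u' => fun x z a c => ∑' n : Site (d + 1), S₂ κ u κ' (translate M u' n) x z a c) μ y ν y' x z a c := by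
  have hCK : 0 ≤ CK := hK.nonneg (Sum.inl 0)
  have hC₂ : 0 ≤ C₂ := by
    have h := (hS₂ 0 0 0 0).nonneg (Sum.inl 0)
    rwa [sub_self, show l1 (0 : Site (d + 1)) = 0 by simp [l1], mul_zero, Real.exp_zero, mul_one] at h
  set r : ℝ := min δK δ₂ with hr
  have hr0 : 0 < r := lt_min hδK hδ₂
  have hZl : 0 ≤ ExpKernelCalculus.Zl (d + 1) (r / 2) := ExpKernelCalculus.Zl_nonneg (half_pos hr0)
  set F : Site (d + 1) → Fin (d + 1) → Site (d + 1) → MKer (d + 1) (Fib d) :=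
    fun n κ u => vertexOfK K N (fun κ' u' => S₂ κ u κ' (translate M u' n)) ν y' with hF
  have hFb : ∀ n κ u x z a c, |F n κ u x z a c|
      ≤ ((d + 1 : ℕ) * (CK * C₂ * ExpKernelCalculus.Zl (d + 1) (r / 2))) * Real.exp (-(r / 2) * l1 (translate M ((N : ℤ) • y') n - u)) := by
    intro n κ u x z a c
    have h := abs_vertexOfK_le_of_far (N := N) hK hδK (F := fun κ' u' => S₂ κ u κ' (translate M u' n)) (q := translate M u (-n))
      (fun κ' u' x z a c => abs_S₂_copy_le M hS₂ hδ₂.le κ u n κ' u' x z a c) hC₂ hδ₂ ν y' x z a c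
    have e : l1 (translate M u (-n) - (N : ℤ) • y') = l1 (translate M ((N : ℤ) • y') n - u) := by
      rw [l1_sub_symm]; congr 1; funext i; simp only [Pi.sub_apply, translate_apply, Pi.neg_apply, mul_neg]; ring
    rw [e] at h
    exact h
  have h1 : ∀ n, vertex2OfK K N S₂ μ y ν (translate M' y' n) = vertexOfK K N (F n) μ y := by
    intro n
    show vertexOfK K N (fun κ u => vertexOfK K N (S₂ κ u) ν (translate M' y' n)) μ y = _
    congr 1
    funext κ u
    exact vertexOfK_translate_per M hM hKinv (S₂ κ u) ν y' n
  simp only [h1]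
  rw [tsum_vertexOfK_slot M hK hδK hFb (by positivity) (half_pos hr0) μ y x z a c]
  show vertexOfK K N (fun κ u => fun x z a c => ∑' n : Site (d + 1), F n κ u x z a c) μ y x z a c = _
  congr 1
  funext κ u x' z' a' c'
  rw [hF]
  dsimp only
  rw [← (Equiv.neg (Site (d + 1))).tsum_eq fun n => vertexOfK K N (fun κ' u' => S₂ κ u κ' (translate M u' n)) ν y' x' z' a' c']
  have hG : ∀ n κ' u' x z a c, |S₂ κ u κ' (translate M u' ((Equiv.neg (Site (d + 1))) n)) x z a c| ≤ C₂ * Real.exp (-δ₂ * l1 (translate M u n - u')) := by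
    intro n κ' u' x z a c
    have h := abs_S₂_copy_le M hS₂ hδ₂.le κ u (-n) κ' u' x z a c
    rw [neg_neg] at h
    exact h
  rw [tsum_vertexOfK_slot M hK hδK hG hC₂ hδ₂ ν y' x' z' a' c']
  congr 1
  funext κ' u' x'' z'' a'' c''
  exact (Equiv.neg (Site (d + 1))).tsum_eq fun n => S₂ κ u κ' (translate M u' n) x'' z'' a'' c''

/-- [folklore] the copy-summed table `S₂^{csf} κ u κ′ u′` is localised at its first bond `u`, UNIFORMLY in the second (constant `C₂·K_{d+1}(δ₂)`). -/
theorem biLoc_S₂_csf (hS₂ : LocStencil₂ S₂ C₂ δ₂) (hδ₂ : 0 < δ₂) (κ : Fin (d + 1)) (u : Site (d + 1)) (κ' : Fin (d + 1)) (u' : Site (d + 1)) :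
    BiLoc (fun x z a c => ∑' n : Site (d + 1), S₂ κ u κ' (translate M u' n) x z a c) u u (C₂ * latticeConst (d + 1) δ₂) δ₂ := by
  have hC₂ : 0 ≤ C₂ := by
    have h := (hS₂ 0 0 0 0).nonneg (Sum.inl 0)
    rwa [sub_self, show l1 (0 : Site (d + 1)) = 0 by simp [l1], mul_zero, Real.exp_zero, mul_one] at h
  have hT : ∀ n x z a c, |S₂ κ u κ' (translate M u' n) x z a c|
      ≤ (C₂ * Real.exp (-δ₂ * l1 (translate M u' n - u))) * Real.exp (-δ₂ * (l1 (x - u) + l1 (z - u))) :=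
    fun n x z a c => hS₂ κ u κ' (translate M u' n) x z a c
  obtain ⟨hs, hle⟩ := summable_exp_l1_translate M hδ₂ u u'
  have h := CombHId2CopySum.biLoc_tsum_family (T := fun n => S₂ κ u κ' (translate M u' n)) hT (hs.mul_left C₂)
  refine BalabanStepW2.biLoc_le_mono h (tsum_nonneg fun n => by positivity) ?_ le_rfl
  rw [tsum_mul_left]
  exact mul_le_mul_of_nonneg_left hle hC₂

omit [NeZero N] in
/-- [folklore] **WORD 1, PERIODISED**: `dper M (x z ↦ Σ'_n vertex2OfK K N S₂ b (b′+M′∘n) x z) = vertex2OfK K N S₂^{per,csf} b b′`,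
`S₂^{per,csf} κ u κ′ u′ := dper M (x z ↦ Σ'_n S₂ κ u κ′ (u′+M∘n) x z)` — the SAME «copy-sum the second bond, then periodise» shape `CombHId2Record.dper_tsum_T2comb_succ`
delivers for `T2_j` one level down. -/
theorem dper_tsum_word₁₂ (hM : ∀ i, M i = N * M' i)
    (hKinv : ∀ (m x z : Site (d + 1)) (a b : Fib d), K (translate M x m) (translate M z m) a b = K x z a b)
    (hK : Decays K CK δK) (hδK : 0 < δK) (hS₂ : LocStencil₂ S₂ C₂ δ₂) (hδ₂ : 0 < δ₂)
    (μ : Fin (d + 1)) (y : Site (d + 1)) (ν : Fin (d + 1)) (y' : Site (d + 1)) :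
    dper M (fun x z a c => ∑' n : Site (d + 1), vertex2OfK K N S₂ μ y ν (translate M' y' n) x z a c)
      = vertex2OfK K N (fun κ u κ' u' => dper M (fun x z a c => ∑' n : Site (d + 1), S₂ κ u κ' (translate M u' n) x z a c)) μ y ν y' := by
  have hcs := fun κ u => biLoc_S₂_csf M hS₂ hδ₂ κ u
  have hT : ∀ κ u, BiLoc (vertexOfK K N (fun κ' u' => fun x z a c => ∑' n : Site (d + 1), S₂ κ u κ' (translate M u' n) x z a c) ν y') u u
      ((d + 1 : ℕ) * (CK * ExpKernelCalculus.Zl (d + 1) δK) * (C₂ * latticeConst (d + 1) δ₂)) δ₂ :=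
    fun κ u => biLoc_vertexOfK_of_biLocAt (N := N) hK hδK (hcs κ u) ν y'
  have h1 : (fun x z a c => ∑' n : Site (d + 1), vertex2OfK K N S₂ μ y ν (translate M' y' n) x z a c)
      = vertexOfK K N (fun κ u => vertexOfK K N (fun κ' u' => fun x z a c => ∑' n : Site (d + 1), S₂ κ u κ' (translate M u' n) x z a c) ν y') μ y := by
    funext x z a c
    exact tsum_word₁₂ M hM hKinv hK hδK hS₂ hδ₂ μ y ν y' x z a c
  rw [h1, dper_vertexOfK' M hK hδK hT hδ₂ μ y]
  show _ = vertexOfK K N (fun κ u => vertexOfK K N (fun κ' u' => dper M (fun x z a c => ∑' n : Site (d + 1), S₂ κ u κ' (translate M u' n) x z a c)) ν y') μ y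
  congr 1
  funext κ u
  exact dper_vertexOfK_of_biLocAt M (N := N) hK hδK (hcs κ u) hδ₂ ν y'

end Summit.QuantumFields.BalabanUV.Beta.CombHId2W2Vertex2

end
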